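import Summits.AtomisticToContinuum.FouriersLaw.Theses.BondHeatUncertainty

/-!
# `SubdiffusiveBondHeat` / bath-bond reduction, part 3: two-time laws of the constructed flow

Helper file for crux `stmt-AtomisticToContinuum-9120` (`BondHeatUncertainty.SubdiffusiveBondHeat`), line
`bath-bond-deficit-integral`, stub `stub_bathBondReduction`. The crux's bond-current autocorrelation
`C_N(b,s) = ∫ j_b · (P_s j_b) dμ_T` and its once-integrated form `V_N(b,t) = 2∫₀ᵗ (t-s) C_N(b,s) ds` are
KERNEL-LEVEL objects (constructed transition kernels `OscillatorChain.transitionKernel` of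
`LangevinChainKernel.lean`, Gibbs measure `OscillatorChain.gibbsMeasure`); the reduction
`V_N(0,t) = Var_eq(∫₀ᵗ j₀(z_s) ds)` reads them as two-time correlations of the PROCESS
`z_s = Φ_s(x, B)` (the pathwise solution map `OscillatorChain.solMap` driven by the Brownian pair, started
from `x ∼ μ`). This file proves the dictionary between the two, i.e. the simple Markov property of the
constructed flow at two times, in its sharpest (measure-valued) form:

* `pinnedChain_map_solMap_pair` — for `s, t ≥ 0` and every `x`, the joint law of
  `(Φ_s(x,B), Φ_{s+t}(x,B))` under the Wiener pair is the composition-product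
  `P_s(x, ·) ⊗ₘ P_t` (Mathlib `Measure.compProd`): cocycle property of the flow through the shifted pair,
  past-measurability of `Φ_s`, and the weak Markov property of the Brownian pair
  (`Literature.Probability.Process.lintegral_comp_pairShift_eq`) — the same three inputs as the tree's
  Chapman–Kolmogorov equation `pinnedChain_transitionKernel_add`, of which this is the two-time refinement;
* `pinnedChain_lintegral_solMap_pair`, `pinnedChain_integral_solMap_pair` — hence
  `E F(Φ_s, Φ_{s+t}) = ∫∫ F(y, y') P_t(y, dy') P_s(x, dy)` (Lebesgue and Bochner forms);
* `pinnedChain_map_solMap_pair_of_initial` — started from an initial law `μ` (s-finite):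
  the joint law of `(z_s, z_{s+t})` under `μ ⊗ W` is `(μ P_s) ⊗ₘ P_t` with `μ P_s = μ.bind (P_s ·)`;
* `pinnedChain_map_solMap_pair_of_invariant` — so for an INVARIANT initial law (`μ.bind P_s = μ`, clause
  (a) of `BoundaryEscapeDeficit.BoundaryKernelBasics` for the Gibbs measure) it is `μ ⊗ₘ P_t` for every
  `s`: two-time correlations are stationary and equal the kernel-level pairings,
  `E_μ[h(z_s) f(z_{s+t})] = ∫ h · (P_t f) dμ` (`pinnedChain_integral_solMap_pair_of_invariant`).

Pinned chain `pinnedChain ω₂ lam β γ` with `ω₂ > 0`, `lam, β, γ ≥ 0`; all `N`, all `T_L, T_R`.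
Nothing here closes an item.
-/

noncomputable section

open MeasureTheory ProbabilityTheory Filter Topology Set
open scoped NNReal ENNReal
open Literature.MathematicalPhysics.KineticTheory.HeatConduction Literature.Probability.Process

namespace Summit.AtomisticToContinuum.FouriersLaw.Theorems.SubdiffusiveBondHeat

open OscillatorChain

section TwoTime

variable {ω₂ lam β γ : ℝ} (hω : 0 < ω₂) (hl : 0 ≤ lam) (hβ : 0 ≤ β) (hγ : 0 ≤ γ) (N : ℕ) (T_L T_R : ℝ)
include hω hl hβ hγ

/-- **Two-time law of the constructed flow = composition-product of the kernels.** For the pinned chain,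
`s, t ≥ 0` and every initial condition `x`, the joint law of `(Φ_s(x,B), Φ_{s+t}(x,B))` under the Wiener
pair is `P_s(x,·) ⊗ₘ P_t`, i.e. `P{Φ_s ∈ dy, Φ_{s+t} ∈ dy'} = P_s(x,dy) P_t(y,dy')` — the simple Markov
property of the strong solution at two times (cocycle `Φ_{s+t}(x,B(ω)) = Φ_t(Φ_s(x,B(ω)), θ_sω)`,
`Φ_s` past-measurable, shifted pair independent of the past with the law of the pair).
[cite: CuneoEckmannHairerReyBellet2018, §3 p. 7] [folklore] -/
theorem pinnedChain_map_solMap_pair (s t : ℝ≥0) (x : PhaseSpace N) :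
    wienerPair.map (fun ω => ((pinnedChain ω₂ lam β γ).solMap N T_L T_R s x (pairPath ω),
        (pinnedChain ω₂ lam β γ).solMap N T_L T_R ((s + t : ℝ≥0) : ℝ) x (pairPath ω))) =
      ((pinnedChain ω₂ lam β γ).transitionKernel N T_L T_R s x) ⊗ₘ
        ((pinnedChain ω₂ lam β γ).transitionKernel N T_L T_R t) := by
  classical
  set P := pinnedChain ω₂ lam β γ with hP
  set κ := P.transitionKernel N T_L T_R with hκ
  haveI : ∀ u, IsMarkovKernel (κ u) := fun u => pinnedChain_isMarkovKernel_transitionKernel hω hl hβ hγ N T_L T_R u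
  have hm1 : Measurable fun ω => P.solMap N T_L T_R s x (pairPath ω) :=
    pinnedChain_measurable_solMap_pairPath_right hω hl hβ hγ N T_L T_R s x
  have hm2 : Measurable fun ω => P.solMap N T_L T_R ((s + t : ℝ≥0) : ℝ) x (pairPath ω) :=
    pinnedChain_measurable_solMap_pairPath_right hω hl hβ hγ N T_L T_R _ x
  refine Measure.ext fun A hA => ?_
  rw [Measure.map_apply (hm1.prodMk hm2) hA, Measure.compProd_apply hA]
  -- the functional `G(y, w) = 1_A(y, Φ_t(y, w))`
  set F : PhaseSpace N × WienerPair → PhaseSpace N := fun p => P.solMap N T_L T_R t p.1 p.2 with hF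
  have hFm : Measurable F := pinnedChain_measurable_solMap hω hl hβ hγ N T_L T_R t
  set G : PhaseSpace N × WienerPair → ℝ≥0∞ := ((fun p => (p.1, F p)) ⁻¹' A).indicator 1 with hG
  have hGm : Measurable G := measurable_one.indicator ((measurable_fst.prodMk hFm) hA)
  -- the past-measurable position at time `s`
  set ξ : WienerPair → PhaseSpace N := fun ω => P.solMap N T_L T_R s x (pairPath ω) with hξ
  have hξF : Measurable[MeasurableSpace.comap (pairPast s) inferInstance] ξ :=
    pinnedChain_measurable_comap_pairPast_solMap hω hl hβ hγ N T_L T_R s x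
  -- left-hand side through the cocycle property
  have hL : wienerPair ((fun ω => (P.solMap N T_L T_R s x (pairPath ω),
      P.solMap N T_L T_R ((s + t : ℝ≥0) : ℝ) x (pairPath ω))) ⁻¹' A) =
      ∫⁻ ω, G (ξ ω, pairShift s ω) ∂wienerPair := by
    rw [← lintegral_indicator_one ((hm1.prodMk hm2) hA)]
    refine lintegral_congr fun ω => ?_
    simp only [hG, hF, hξ, Set.indicator_apply, Set.mem_preimage, NNReal.coe_add, Pi.one_apply]
    rw [pinnedChain_solMap_add_pairPath hω hl hβ hγ N T_L T_R s t.coe_nonneg x ω]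
  -- right-hand side: `∫ P_t(y, A_y) P_s(x, dy)`
  have hR : ∫⁻ y, κ t y (Prod.mk y ⁻¹' A) ∂(κ s x) = ∫⁻ ω, ∫⁻ ω', G (ξ ω, pairPath ω') ∂wienerPair ∂wienerPair := by
    rw [pinnedChain_lintegral_transitionKernel hω hl hβ hγ N T_L T_R s x (Kernel.measurable_kernel_prodMk_left hA)]
    refine lintegral_congr fun ω => ?_
    rw [pinnedChain_transitionKernel_apply' hω hl hβ hγ N T_L T_R t _ (measurable_prodMk_left hA),
      ← lintegral_indicator_one
        ((pinnedChain_measurable_solMap_pairPath_right hω hl hβ hγ N T_L T_R _ _) (measurable_prodMk_left hA))]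
    refine lintegral_congr fun ω' => ?_
    simp only [hG, hF, hξ, Set.indicator_apply, Set.mem_preimage, Pi.one_apply]
    rfl
  rw [hL, hR]
  exact lintegral_comp_pairShift_eq s hξF hGm

/-- `E F(Φ_s(x,B), Φ_{s+t}(x,B)) = ∫∫ F(y,y') P_t(y,dy') P_s(x,dy)` for measurable `F ≥ 0` (Lebesgue
integral against the composition-product). [folklore] -/
theorem pinnedChain_lintegral_solMap_pair (s t : ℝ≥0) (x : PhaseSpace N)
    {F : PhaseSpace N × PhaseSpace N → ℝ≥0∞} (hF : Measurable F) :
    ∫⁻ ω, F ((pinnedChain ω₂ lam β γ).solMap N T_L T_R s x (pairPath ω),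
        (pinnedChain ω₂ lam β γ).solMap N T_L T_R ((s + t : ℝ≥0) : ℝ) x (pairPath ω)) ∂wienerPair =
      ∫⁻ p, F p ∂(((pinnedChain ω₂ lam β γ).transitionKernel N T_L T_R s x) ⊗ₘ
        ((pinnedChain ω₂ lam β γ).transitionKernel N T_L T_R t)) := by
  have hm : Measurable fun ω => ((pinnedChain ω₂ lam β γ).solMap N T_L T_R s x (pairPath ω),
      (pinnedChain ω₂ lam β γ).solMap N T_L T_R ((s + t : ℝ≥0) : ℝ) x (pairPath ω)) :=
    (pinnedChain_measurable_solMap_pairPath_right hω hl hβ hγ N T_L T_R s x).prodMk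
      (pinnedChain_measurable_solMap_pairPath_right hω hl hβ hγ N T_L T_R _ x)
  rw [← pinnedChain_map_solMap_pair hω hl hβ hγ N T_L T_R s t x, lintegral_map hF hm]

/-- `E F(Φ_s(x,B), Φ_{s+t}(x,B)) = ∫ F d(P_s(x,·) ⊗ₘ P_t)` for (ae-strongly) measurable real `F` (Bochner
integral; both sides are `0` together when `F` is not integrable). [folklore] -/
theorem pinnedChain_integral_solMap_pair (s t : ℝ≥0) (x : PhaseSpace N)
    {F : PhaseSpace N × PhaseSpace N → ℝ}
    (hF : AEStronglyMeasurable F (((pinnedChain ω₂ lam β γ).transitionKernel N T_L T_R s x) ⊗ₘ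
        ((pinnedChain ω₂ lam β γ).transitionKernel N T_L T_R t))) :
    ∫ ω, F ((pinnedChain ω₂ lam β γ).solMap N T_L T_R s x (pairPath ω),
        (pinnedChain ω₂ lam β γ).solMap N T_L T_R ((s + t : ℝ≥0) : ℝ) x (pairPath ω)) ∂wienerPair =
      ∫ p, F p ∂(((pinnedChain ω₂ lam β γ).transitionKernel N T_L T_R s x) ⊗ₘ
        ((pinnedChain ω₂ lam β γ).transitionKernel N T_L T_R t)) := by
  have hm : Measurable fun ω => ((pinnedChain ω₂ lam β γ).solMap N T_L T_R s x (pairPath ω),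
      (pinnedChain ω₂ lam β γ).solMap N T_L T_R ((s + t : ℝ≥0) : ℝ) x (pairPath ω)) :=
    (pinnedChain_measurable_solMap_pairPath_right hω hl hβ hγ N T_L T_R s x).prodMk
      (pinnedChain_measurable_solMap_pairPath_right hω hl hβ hγ N T_L T_R _ x)
  rw [← pinnedChain_map_solMap_pair hω hl hβ hγ N T_L T_R s t x] at hF ⊢
  rw [integral_map hm.aemeasurable hF]

/-- **Two-time law from an initial distribution.** For an s-finite initial law `μ` on phase space, the
joint law of `(z_s, z_{s+t})`, `z_u(x, ω) = Φ_u(x, B(ω))`, under `μ ⊗ W` is `(μP_s) ⊗ₘ P_t` with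
`μP_s = μ.bind P_s` the law at time `s`. [folklore] -/
theorem pinnedChain_map_solMap_pair_of_initial (μ : Measure (PhaseSpace N)) [SFinite μ] (s t : ℝ≥0) :
    (μ.prod wienerPair).map (fun p => ((pinnedChain ω₂ lam β γ).solMap N T_L T_R s p.1 (pairPath p.2),
        (pinnedChain ω₂ lam β γ).solMap N T_L T_R ((s + t : ℝ≥0) : ℝ) p.1 (pairPath p.2))) =
      (μ.bind ((pinnedChain ω₂ lam β γ).transitionKernel N T_L T_R s)) ⊗ₘ
        ((pinnedChain ω₂ lam β γ).transitionKernel N T_L T_R t) := by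
  set P := pinnedChain ω₂ lam β γ with hP
  set κ := P.transitionKernel N T_L T_R with hκ
  haveI : ∀ u, IsMarkovKernel (κ u) := fun u => pinnedChain_isMarkovKernel_transitionKernel hω hl hβ hγ N T_L T_R u
  -- joint measurability of the pair map on `PhaseSpace × WienerPair`
  have hjm : ∀ u : ℝ, Measurable fun p : PhaseSpace N × WienerPair => P.solMap N T_L T_R u p.1 (pairPath p.2) :=
    fun u => pinnedChain_measurable_solMap_pairPath hω hl hβ hγ N T_L T_R u
  have hm : Measurable fun p : PhaseSpace N × WienerPair =>
      (P.solMap N T_L T_R s p.1 (pairPath p.2), P.solMap N T_L T_R ((s + t : ℝ≥0) : ℝ) p.1 (pairPath p.2)) :=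
    (hjm s).prodMk (hjm _)
  have hκm : Measurable (κ s : PhaseSpace N → Measure (PhaseSpace N)) := (κ s).measurable
  refine Measure.ext fun A hA => ?_
  rw [Measure.map_apply hm hA, Measure.prod_apply (hm hA), Measure.compProd_apply hA,
    Measure.lintegral_bind hκm.aemeasurable (Kernel.measurable_kernel_prodMk_left hA).aemeasurable]
  refine lintegral_congr fun x => ?_
  have hx := congrArg (fun ν : Measure (PhaseSpace N × PhaseSpace N) => ν A)
    (pinnedChain_map_solMap_pair hω hl hβ hγ N T_L T_R s t x)
  rw [Measure.map_apply ((pinnedChain_measurable_solMap_pairPath_right hω hl hβ hγ N T_L T_R s x).prodMk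
    (pinnedChain_measurable_solMap_pairPath_right hω hl hβ hγ N T_L T_R _ x)) hA,
    Measure.compProd_apply hA] at hx
  rw [← hx]
  rfl

/-- **Stationary two-time law.** If the initial law `μ` is invariant for the kernel at time `s`
(`μ.bind P_s = μ` — for the Gibbs measure at `T_L = T_R = T` this is clause (a) of
`BoundaryEscapeDeficit.BoundaryKernelBasics`), the joint law of `(z_s, z_{s+t})` under `μ ⊗ W` is
`μ ⊗ₘ P_t`, independently of `s`. [folklore] -/
theorem pinnedChain_map_solMap_pair_of_invariant (μ : Measure (PhaseSpace N)) [SFinite μ] (s t : ℝ≥0)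
    (hinv : μ.bind ((pinnedChain ω₂ lam β γ).transitionKernel N T_L T_R s) = μ) :
    (μ.prod wienerPair).map (fun p => ((pinnedChain ω₂ lam β γ).solMap N T_L T_R s p.1 (pairPath p.2),
        (pinnedChain ω₂ lam β γ).solMap N T_L T_R ((s + t : ℝ≥0) : ℝ) p.1 (pairPath p.2))) =
      μ ⊗ₘ ((pinnedChain ω₂ lam β γ).transitionKernel N T_L T_R t) := by
  rw [pinnedChain_map_solMap_pair_of_initial hω hl hβ hγ N T_L T_R μ s t, hinv]

/-- **Stationary two-time correlations are the kernel pairings**: under an invariant initial law `μ`,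
`E_{μ⊗W}[h(z_s) f(z_{s+t})] = ∫ h(y) (∫ f dP_t(y,·)) dμ(y)` for real `h, f` with `h ⊗ f` integrable
against `μ ⊗ₘ P_t` (e.g. `C_N(b,t) = E_μ[j_b(z_s) j_b(z_{s+t})]`, `K_N(t) = E_μ[(p₀²-T)(z_s)(p₀²-T)(z_{s+t})]`).
[folklore] -/
theorem pinnedChain_integral_solMap_pair_of_invariant (μ : Measure (PhaseSpace N)) [SFinite μ] (s t : ℝ≥0)
    (hinv : μ.bind ((pinnedChain ω₂ lam β γ).transitionKernel N T_L T_R s) = μ)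
    {h f : PhaseSpace N → ℝ}
    (hhf : Integrable (fun p : PhaseSpace N × PhaseSpace N => h p.1 * f p.2)
      (μ ⊗ₘ ((pinnedChain ω₂ lam β γ).transitionKernel N T_L T_R t))) :
    ∫ p, h ((pinnedChain ω₂ lam β γ).solMap N T_L T_R s p.1 (pairPath p.2)) *
        f ((pinnedChain ω₂ lam β γ).solMap N T_L T_R ((s + t : ℝ≥0) : ℝ) p.1 (pairPath p.2)) ∂(μ.prod wienerPair) =
      ∫ y, h y * (∫ y', f y' ∂((pinnedChain ω₂ lam β γ).transitionKernel N T_L T_R t y)) ∂μ := by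
  set P := pinnedChain ω₂ lam β γ with hP
  set κ := P.transitionKernel N T_L T_R with hκ
  haveI : ∀ u, IsMarkovKernel (κ u) := fun u => pinnedChain_isMarkovKernel_transitionKernel hω hl hβ hγ N T_L T_R u
  have hjm : ∀ u : ℝ, Measurable fun p : PhaseSpace N × WienerPair => P.solMap N T_L T_R u p.1 (pairPath p.2) :=
    fun u => pinnedChain_measurable_solMap_pairPath hω hl hβ hγ N T_L T_R u
  have hm : Measurable fun p : PhaseSpace N × WienerPair =>
      (P.solMap N T_L T_R s p.1 (pairPath p.2), P.solMap N T_L T_R ((s + t : ℝ≥0) : ℝ) p.1 (pairPath p.2)) :=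
    (hjm s).prodMk (hjm _)
  have hlaw := pinnedChain_map_solMap_pair_of_invariant hω hl hβ hγ N T_L T_R μ s t hinv
  have h1 : ∫ p, h (P.solMap N T_L T_R s p.1 (pairPath p.2)) *
      f (P.solMap N T_L T_R ((s + t : ℝ≥0) : ℝ) p.1 (pairPath p.2)) ∂(μ.prod wienerPair) =
      ∫ q, (fun q : PhaseSpace N × PhaseSpace N => h q.1 * f q.2) q ∂((μ.prod wienerPair).map
        (fun p => (P.solMap N T_L T_R s p.1 (pairPath p.2),
          P.solMap N T_L T_R ((s + t : ℝ≥0) : ℝ) p.1 (pairPath p.2)))) := by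
    rw [integral_map hm.aemeasurable]
    rw [hlaw]; exact hhf.aestronglyMeasurable
  rw [h1, hlaw, Measure.integral_compProd hhf]
  refine integral_congr_ae (Eventually.of_forall fun y => ?_)
  simp only
  exact integral_const_mul _ _

end TwoTime

/-- **Two-time law of the constructed flow** (registered sub-goal of `stub_bathBondReduction`; closed form of
`pinnedChain_map_solMap_pair`): for the pinned chain (`ω₂ > 0`, `lam, β, γ ≥ 0`), all `N, T_L, T_R`,
`s, t ≥ 0` and every `x`, the joint law of `(Φ_s(x,B), Φ_{s+t}(x,B))` under the Wiener pair is
`P_s(x,·) ⊗ₘ P_t`. [folklore] -/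
theorem pinnedChain_twoTimeLaw :
    ∀ (ω₂ lam β γ : ℝ), 0 < ω₂ → 0 ≤ lam → 0 ≤ β → 0 ≤ γ → ∀ (N : ℕ) (T_L T_R : ℝ) (s t : NNReal) (x : PhaseSpace N),
      Literature.Probability.Process.wienerPair.map (fun ω =>
          ((pinnedChain ω₂ lam β γ).solMap N T_L T_R s x (Literature.Probability.Process.pairPath ω),
            (pinnedChain ω₂ lam β γ).solMap N T_L T_R ((s + t : NNReal) : ℝ) x
              (Literature.Probability.Process.pairPath ω))) =
        MeasureTheory.Measure.compProd ((pinnedChain ω₂ lam β γ).transitionKernel N T_L T_R s x)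
          ((pinnedChain ω₂ lam β γ).transitionKernel N T_L T_R t) := by
  intro ω₂ lam β γ hω hl hβ hγ N T_L T_R s t x
  exact pinnedChain_map_solMap_pair hω hl hβ hγ N T_L T_R s t x

end Summit.AtomisticToContinuum.FouriersLaw.Theorems.SubdiffusiveBondHeat
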